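import Summits.Ventures.PercRepro.RankLevelSetRuleQStaircaseMaps
import Summits.Ventures.PercRepro.RankLevelSetRuleQCellFiveSliceTen
import Summits.Ventures.PercRepro.RankLevelSetRuleQCellSixSliceTen
import Summits.Ventures.PercRepro.RankLevelSetRuleQCellSevenSliceTen
import Summits.Ventures.PercRepro.RankLevelSetRuleQCellEightSliceTen
import Summits.Ventures.PercRepro.RankLevelSetRuleQCellNineSliceTen
import Summits.Ventures.PercRepro.RankLevelSetRuleQCellTenSliceTen

/-!
# PercRepro — THE STAIRCASE UP TO `u = 10`: THE SLICES `k − 1 ≤ u ≤ 10` OF EVERY CELL `(q+k, q)`, `5 ≤ k ≤ 10`; THE EXACT MAPS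
OF `k = 5, 6, 7` UP TO `u = 10` (night-1, gen 18; dossier §29.8)

* **`rhat_staircase_ten`** — `Φ(q+k, q) ≤ R̂(q, k, q − u)` for every `5 ≤ k ≤ 10`, `k − 1 ≤ u ≤ 10`, `q ≥ u` (`rhat_staircase` plus
  the six `u = 10` slice theorems `rhat_five_slice_ten_all … rhat_ten_slice_ten_all`, read through the family-12 forms);
* **`rhat_five_slice_iff_ten`**, **`rhat_six_slice_iff_ten`**, **`rhat_seven_slice_iff_ten`** — the exact thin-slice maps up to `u = 10`:
  a slice `u ≤ 10` is paid on every cell iff `u ≠ 2` (`k = 5`), iff `u ∉ {2, 3}` (`k = 6`), iff `u ∉ {2, 3, 4}` (`k = 7`);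
* **`ruleQRecv_ge_phiK_staircase_ten`** — the matroid level. Axioms: standard.
-/

namespace PercRepro

open Set Matroid Finset

/-- **The staircase for `5 ≤ k ≤ 10`, `k − 1 ≤ u ≤ 10`**: `Φ(q+k, q) ≤ R̂(q, k, q − u)` for every `q ≥ u`. -/
theorem rhat_staircase_ten (k u q : ℕ) (hk5 : 5 ≤ k) (hk10 : k ≤ 10) (hku : k - 1 ≤ u) (hu10 : u ≤ 10) (hq : u ≤ q) :
    phiK (q + k) q ≤ rhat q k (q - u) := by
  rcases Nat.lt_or_ge u 10 with hlt | hge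
  · exact rhat_staircase k u q hk5 hk10 hku (by omega) hq
  · have hu : u = 10 := by omega
    subst hu
    interval_cases k
    · exact rhat_five_slice_ten_all q hq
    · exact rhat_six_slice_ten_all q hq
    · exact rhat_seven_slice_ten_all q hq
    · exact rhat_eight_slice_ten_all q hq
    · exact rhat_nine_slice_ten_all q hq
    · exact rhat_ten_slice_ten_all q hq

/-- **The slices `u ≤ 10` of the family `k = 5`, exactly**: paid on EVERY cell `(q+5, q)` iff `u ≠ 2`. -/
theorem rhat_five_slice_iff_ten (u : ℕ) (hu10 : u ≤ 10) :
    (∀ q, u ≤ q → phiK (q + 5) q ≤ rhat q 5 (q - u)) ↔ u ≠ 2 := by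
  rcases Nat.lt_or_ge u 10 with hlt | hge
  · exact rhat_five_slice_iff u (by omega)
  · have hu : u = 10 := by omega
    subst hu
    exact ⟨fun _ => by norm_num, fun _ q hq => rhat_five_slice_ten_all q hq⟩

/-- **The slices `u ≤ 10` of the family `k = 6`, exactly**: paid on EVERY cell `(q+6, q)` iff `u ∉ {2, 3}`. -/
theorem rhat_six_slice_iff_ten (u : ℕ) (hu10 : u ≤ 10) :
    (∀ q, u ≤ q → phiK (q + 6) q ≤ rhat q 6 (q - u)) ↔ (u ≠ 2 ∧ u ≠ 3) := by
  rcases Nat.lt_or_ge u 10 with hlt | hge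
  · exact rhat_six_slice_iff u (by omega)
  · have hu : u = 10 := by omega
    subst hu
    exact ⟨fun _ => by norm_num, fun _ q hq => rhat_six_slice_ten_all q hq⟩

/-- **The slices `u ≤ 10` of the family `k = 7`, exactly**: paid on EVERY cell `(q+7, q)` iff `u ∉ {2, 3, 4}`. -/
theorem rhat_seven_slice_iff_ten (u : ℕ) (hu10 : u ≤ 10) :
    (∀ q, u ≤ q → phiK (q + 7) q ≤ rhat q 7 (q - u)) ↔ (u ≠ 2 ∧ u ≠ 3 ∧ u ≠ 4) := by
  rcases Nat.lt_or_ge u 10 with hlt | hge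
  · exact rhat_seven_slice_iff u (by omega)
  · have hu : u = 10 := by omega
    subst hu
    exact ⟨fun _ => by norm_num, fun _ q hq => rhat_seven_slice_ten_all q hq⟩

variable {α : Type} (M : Matroid α) [M.Finite]

/-- **The matroid level of the staircase up to `u = 10`**: at the tight layer of the cell `(q+k, q)`, `5 ≤ k ≤ 10`, every member
`Z` with `#(flatPart M Z) = q − u`, `k − 1 ≤ u ≤ 10`, receives at least `Φ(q+k, q)` under Rule Q's equal split. -/
theorem ruleQRecv_ge_phiK_staircase_ten {q k u : ℕ} (hk5 : 5 ≤ k) (hk10 : k ≤ 10) (hku : k - 1 ≤ u) (hu10 : u ≤ 10) (hq : u ≤ q)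
    (hE : M.E.ncard = (q + k) + q) {Z : Set α} (hZ : Z ∈ cellMembers M (q + k) q)
    (hP : (flatPart M Z).ncard = q - u) :
    phiK (q + k) q ≤ ruleQRecv M (q + k) q Z := by
  have h1 := rhat_staircase_ten k u q hk5 hk10 hku hu10 hq
  have h2 := rhat_le_ruleQRecv M hE hZ
  rw [hP] at h2
  exact h1.trans h2

end PercRepro
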